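import Summits.AtomisticToContinuum.FouriersLaw.Theorems.OddSectorIrreversibilityTapLeakBoundSplitGlue
import Summits.AtomisticToContinuum.FouriersLaw.Theorems.OddSectorIrreversibilityWitnessGlueLeak

/-!
# `TapLeakBound` (stmt-AtomisticToContinuum-15159), line `SketchIdeator2`, stub `stub_parityNorm`

Helper file (`--supports stmt-AtomisticToContinuum-15159`; proves the registered stub `stub_parityNorm`)
for crux P = `Summit.AtomisticToContinuum.FouriersLaw.Theses.OddSectorIrreversibility.TapLeakBound`
(route `OddSectorIrreversibility`, sub-problem `FouriersLaw`).

**Parity of the Ornstein–Uhlenbeck tap operator.** Write `Θ(q,p) = (q,−p)` for the momentum reversal,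
`u⁺ = (u + u∘Θ)/2` for the `Θ`-even part, `μ_T = gibbsWeight` for the (unnormalised) Gibbs weight and
`𝒩_b f = −T ∂²_{p_b} f + p_b ∂_{p_b} f` for the tap operator at site `b`.
* Pointwise, for `u ∈ C²`: `∂_{p_b}(f∘Θ) = −(∂_{p_b} f)∘Θ` (chain rule along `t ↦ −t`, in tree as
  `partialP_comp_momentumReversal`), hence `∂_{p_b} u⁺ = (∂_{p_b} u − (∂_{p_b} u)∘Θ)/2` (in tree,
  `partialP_evenPart`), `∂²_{p_b} u⁺ = (∂²_{p_b} u + (∂²_{p_b} u)∘Θ)/2` (`partialP_partialP_evenPart`) and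
  `𝒩_b u⁺ = ((𝒩_b u) + (𝒩_b u)∘Θ)/2` (`tapOp_evenPart`): the tap operator commutes with `Θ`.
* `Θ` preserves `μ_T` (`measurePreserving_momentumReversal_gibbsWeight`: the Hamiltonian is even in `p` and
  Lebesgue measure is `Θ`-invariant), so `F⁺ ∈ L²(μ_T)` whenever `F ∈ L²(μ_T)`, and
  `((a + b)/2)² ≤ (a² + b²)/2` with `∫ (F∘Θ)² dμ_T = ∫ F² dμ_T` gives `∫ (F⁺)² dμ_T ≤ ∫ F² dμ_T`
  (`memLp_evenPart`, `integral_sq_evenPart_le`).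
Together (`F = 𝒩_b u`): `𝒩_b u⁺ ∈ L²(μ_T)` and `‖𝒩_b u⁺‖² ≤ ‖𝒩_b u‖²`, which is `stub_parityNorm` (the
positivity hypotheses on `ω₂, T` and the signs of `lam, β` of the registered signature are not used).
References: folklore.
-/

noncomputable section

open MeasureTheory ProbabilityTheory Filter Topology Set Function
open scoped NNReal ENNReal ContDiff

namespace Summit.AtomisticToContinuum.FouriersLaw.Theorems.OddSectorIrreversibility.TapLeak

open Literature.MathematicalPhysics.KineticTheory.HeatConduction
open Literature.MathematicalPhysics.KineticTheory
open Summit.AtomisticToContinuum.FouriersLaw.Theorems.OddSectorWitness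
open Summit.AtomisticToContinuum.FouriersLaw.Theorems.OddSectorIrreversibility.Corrector

/-! ### Pointwise: the tap operator commutes with the momentum reversal -/

section Pointwise

variable {N : ℕ}

/-- A differentiable `f` is differentiable along every momentum line `s ↦ f(q, p[i ↦ s])`. [folklore] -/
theorem differentiableAt_momentumLine {f : PhaseSpace N → ℝ} (hf : Differentiable ℝ f) (i : Fin N)
    (z : PhaseSpace N) (t : ℝ) :
    DifferentiableAt ℝ (fun s : ℝ => f (z.1, Function.update z.2 i s)) t :=
  (hf _).comp t ((differentiableAt_const z.1).prodMk (hasDerivAt_update z.2 i t).differentiableAt)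

/-- `∂_{p_i} ((f − g)/2) = (∂_{p_i} f − ∂_{p_i} g)/2` for differentiable `f, g`. [folklore] -/
theorem partialP_sub_div_two {f g : PhaseSpace N → ℝ} (hf : Differentiable ℝ f) (hg : Differentiable ℝ g)
    (i : Fin N) (z : PhaseSpace N) :
    partialP i (fun y => (f y - g y) / 2) z = (partialP i f z - partialP i g z) / 2 := by
  simp only [partialP]
  rw [deriv_div_const, deriv_fun_sub (differentiableAt_momentumLine hf i z _)
    (differentiableAt_momentumLine hg i z _)]

/-- `∂²_{p_b} u⁺ = (∂²_{p_b} u + (∂²_{p_b} u)∘Θ)/2` for `u ∈ C²`: the second momentum derivative of the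
`Θ`-even part `u⁺ = (u + u∘Θ)/2` is the `Θ`-even part of the second momentum derivative. [folklore] -/
theorem partialP_partialP_evenPart {u : PhaseSpace N → ℝ} (hu : ContDiff ℝ 2 u) (b : Fin N)
    (x : PhaseSpace N) :
    partialP b (partialP b (fun y : PhaseSpace N => (u y + u (y.1, -y.2)) / 2)) x =
      (partialP b (partialP b u) x + partialP b (partialP b u) (x.1, -x.2)) / 2 := by
  have hu1 : ContDiff ℝ 1 u := hu.of_le (by norm_num)
  have h1 : partialP b (fun y : PhaseSpace N => (u y + u (y.1, -y.2)) / 2) =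
      fun y => (partialP b u y - partialP b u (y.1, -y.2)) / 2 :=
    funext fun y => partialP_evenPart N hu1 b y
  have hG : ContDiff ℝ 1 (partialP b u) := contDiff_partialP hu (by norm_num) b
  have hGd : Differentiable ℝ (partialP b u) := hG.differentiable one_ne_zero
  have hGΘ : Differentiable ℝ (fun y : PhaseSpace N => partialP b u (y.1, -y.2)) :=
    hGd.comp (differentiable_fst.prodMk differentiable_snd.neg)
  rw [h1, partialP_sub_div_two hGd hGΘ, partialP_comp_momentumReversal N (partialP b u) b x]
  ring

/-- **The tap operator commutes with the momentum reversal.** For `u ∈ C²` and every `T`,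
`𝒩_b u⁺ (x) = ((𝒩_b u)(x) + (𝒩_b u)(Θx))/2` with `𝒩_b = −T∂²_{p_b} + p_b∂_{p_b}` (note `(Θx).p_b = −p_b` and
`∂_{p_b} u⁺ = (∂_{p_b} u − (∂_{p_b} u)∘Θ)/2`). [folklore] -/
theorem tapOp_evenPart (T : ℝ) {u : PhaseSpace N → ℝ} (hu : ContDiff ℝ 2 u) (b : Fin N) (x : PhaseSpace N) :
    -(T * partialP b (partialP b (fun y : PhaseSpace N => (u y + u (y.1, -y.2)) / 2)) x) +
        x.2 b * partialP b (fun y : PhaseSpace N => (u y + u (y.1, -y.2)) / 2) x =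
      ((-(T * partialP b (partialP b u) x) + x.2 b * partialP b u x) +
        (-(T * partialP b (partialP b u) (x.1, -x.2)) + (x.1, -x.2).2 b * partialP b u (x.1, -x.2))) / 2 := by
  rw [partialP_partialP_evenPart hu, partialP_evenPart N (hu.of_le (by norm_num)) b x]
  simp only [Pi.neg_apply]
  ring

end Pointwise

/-! ### The `Θ`-even part in `L²(μ_T)` -/

section EvenPart

variable {ω₂ lam β γ : ℝ} {N : ℕ} {T : ℝ}

/-- The even part `F⁺ = (F + F∘Θ)/2` of a square-integrable `F` is square integrable (`Θ` preserves the Gibbs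
weight). [folklore] -/
theorem memLp_evenPart {F : PhaseSpace N → ℝ} (hF : MemLp F 2 (gibbsWeight ω₂ lam β γ N T)) :
    MemLp (fun x : PhaseSpace N => (F x + F (x.1, -x.2)) / 2) 2 (gibbsWeight ω₂ lam β γ N T) := by
  -- adapted from `OddSectorWitness.memLp_oddPart` (WitnessGluePairing)
  have h := (hF.add (memLp_comp_momentumReversal γ N hF)).const_mul (1 / 2 : ℝ)
  refine h.ae_eq (Eventually.of_forall fun x => ?_)
  simp only [Pi.add_apply]
  ring

/-- `∫ (F⁺)² dμ_T ≤ ∫ F² dμ_T`: pointwise `((a + b)/2)² ≤ (a² + b²)/2`, and `∫ (F∘Θ)² dμ_T = ∫ F² dμ_T` because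
`Θ` preserves the Gibbs weight. [folklore] -/
theorem integral_sq_evenPart_le {F : PhaseSpace N → ℝ} (hF : MemLp F 2 (gibbsWeight ω₂ lam β γ N T)) :
    ∫ x, ((F x + F (x.1, -x.2)) / 2) ^ 2 ∂(gibbsWeight ω₂ lam β γ N T) ≤
      ∫ x, (F x) ^ 2 ∂(gibbsWeight ω₂ lam β γ N T) := by
  -- adapted from `OddSectorWitness.integral_sq_oddPart_le` (WitnessGluePairing)
  have h1 : Integrable (fun x => (F x) ^ 2) (gibbsWeight ω₂ lam β γ N T) :=
    (memLp_two_iff_integrable_sq hF.aestronglyMeasurable).1 hF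
  have h2 : Integrable (fun x => (F (x.1, -x.2)) ^ 2) (gibbsWeight ω₂ lam β γ N T) :=
    (memLp_two_iff_integrable_sq (memLp_comp_momentumReversal γ N hF).aestronglyMeasurable).1
      (memLp_comp_momentumReversal γ N hF)
  calc ∫ x, ((F x + F (x.1, -x.2)) / 2) ^ 2 ∂(gibbsWeight ω₂ lam β γ N T)
      ≤ ∫ x, ((F x) ^ 2 + (F (x.1, -x.2)) ^ 2) / 2 ∂(gibbsWeight ω₂ lam β γ N T) := by
        refine integral_mono_of_nonneg (Eventually.of_forall fun x => sq_nonneg _) ((h1.add h2).div_const 2)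
          (Eventually.of_forall fun x => ?_)
        nlinarith [sq_nonneg (F x - F (x.1, -x.2))]
    _ = ∫ x, (F x) ^ 2 ∂(gibbsWeight ω₂ lam β γ N T) := by
        rw [integral_div, integral_add h1 h2, integral_sq_comp_momentumReversal γ N F]
        ring

/-- If `G` is pointwise the `Θ`-even part of a square-integrable `F`, then `G ∈ L²(μ_T)` and
`∫ G² dμ_T ≤ ∫ F² dμ_T`. [folklore] -/
theorem memLp_and_integral_sq_le_of_eq_evenPart {F G : PhaseSpace N → ℝ}
    (hF : MemLp F 2 (gibbsWeight ω₂ lam β γ N T)) (hG : ∀ x, G x = (F x + F (x.1, -x.2)) / 2) :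
    MemLp G 2 (gibbsWeight ω₂ lam β γ N T) ∧
      ∫ x, (G x) ^ 2 ∂(gibbsWeight ω₂ lam β γ N T) ≤ ∫ x, (F x) ^ 2 ∂(gibbsWeight ω₂ lam β γ N T) := by
  have hfun : G = fun x => (F x + F (x.1, -x.2)) / 2 := funext hG
  subst hfun
  exact ⟨memLp_evenPart hF, integral_sq_evenPart_le hF⟩

end EvenPart

/-- **Registered stub `stub_parityNorm` of line `SketchIdeator2`** (fixed `N`; parity). The Ornstein–Uhlenbeck
tap operator `𝒩_b = −T∂²_{p_b} + p_b∂_{p_b}` commutes with the momentum reversal `Θ(q,p) = (q,−p)`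
(`tapOp_evenPart`: `𝒩_b u⁺ = (𝒩_b u)⁺` for `u ∈ C²`), and `Θ` preserves the Gibbs weight `μ_T`, so
`𝒩_b u⁺ ∈ L²(μ_T)` whenever `𝒩_b u ∈ L²(μ_T)`, with `‖𝒩_b u⁺‖²_{L²(μ_T)} ≤ ‖𝒩_b u‖²_{L²(μ_T)}`. [folklore] -/
theorem stub_parityNorm : ∀ {ω₂ lam β γ : ℝ}, 0 < ω₂ → 0 ≤ lam → 0 ≤ β → ∀ {T : ℝ}, 0 < T →
    ∀ {N : ℕ} (b : Fin N) {u : PhaseSpace N → ℝ}, ContDiff ℝ 2 u →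
    MemLp (fun x : PhaseSpace N => -(T * partialP b (partialP b u) x) + x.2 b * partialP b u x) 2
      (gibbsWeight ω₂ lam β γ N T) →
    MemLp (fun x : PhaseSpace N => -(T * partialP b (partialP b (fun y : PhaseSpace N => (u y + u (y.1, -y.2)) / 2)) x) +
      x.2 b * partialP b (fun y : PhaseSpace N => (u y + u (y.1, -y.2)) / 2) x) 2 (gibbsWeight ω₂ lam β γ N T) ∧
    ∫ x, (-(T * partialP b (partialP b (fun y : PhaseSpace N => (u y + u (y.1, -y.2)) / 2)) x) +
        x.2 b * partialP b (fun y : PhaseSpace N => (u y + u (y.1, -y.2)) / 2) x) ^ 2 ∂(gibbsWeight ω₂ lam β γ N T) ≤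
      ∫ x, (-(T * partialP b (partialP b u) x) + x.2 b * partialP b u x) ^ 2 ∂(gibbsWeight ω₂ lam β γ N T) := by
  intro ω₂ lam β γ _ _ _ T _ N b u hu hF
  exact memLp_and_integral_sq_le_of_eq_evenPart hF fun x => tapOp_evenPart T hu b x

end Summit.AtomisticToContinuum.FouriersLaw.Theorems.OddSectorIrreversibility.TapLeak

end
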